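import Literature.MathematicalPhysics.QuantumLattice.SU2HaarChart
import Mathlib.Analysis.Calculus.ParametricIntegral
import Mathlib.MeasureTheory.Measure.Haar.NormedSpace
import Mathlib.MeasureTheory.Integral.Pi
import HarnessLib

/-!
# The DILATION IDENTITY in the product gnomonic chart (brick G2 of the virial programme V2′-F, fcl-p3 g45's memo 2 v2 §2′):
# `∫ (X g)·ρ = ∫ g·(Σ_i W(η_i) − 3|ι|)·ρ` on `(ℝ³)^ι` with the gnomonic weight `ρ(η) = ∏_i (1 + |η_i|²)⁻²`
# (free-hands support of ⟨stmt-QuantumFields-24197⟩ `SwapVirialDeficit.SwapGluedStiffness`)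

fcl-p3 g45's memo 2 v2 (HOME `fcl-p3-g45-memo2-24197-window.md` §2′): in the GNOMONIC chart of `SU(2)` (✓`Literature…lintegral_haarProbability_su2_gnomonic`:
Haar = `(2π²)⁻¹·[(1+|v|²)⁻² dv]` on each hemisphere, `v ∈ ℝ³`, NO side condition) the blow-up is the linear dilation `v ↦ e^s v`, and integration by parts
for its Euler field `X` has NO boundary term — the weight's dilation defect `W(v) = 4|v|²/(1+|v|²)` appears instead.  This file is the pure real analysis
of that identity on the follower space `(ℝ³)^ι`, for an ABSTRACT bounded integrand `g` (no ring, no quaternions):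

* §1 `gnomonicWeight v = (1+|v|²)⁻²`, `gnomonicW v = 4|v|²/(1+|v|²) ∈ [0, 4]`, `piWeight η = ∏_i w(η_i)`; ★ `lintegral_gnomonicWeight : ∫ w = π²` (the chart
  formula with `F ≡ 1`), `integrable_piWeight`;
* §2 ★ `integral_comp_dilate` — `∫ g(e^s η)·ρ(η) dη = e^{−3|ι|s}·∫ g(η)·ρ(e^{−s}η) dη` (Mathlib `Measure.integral_comp_smul_of_nonneg`, `finrank = 3|ι|`);
* §3 `weightPath η s = e^{−3|ι|s}·ρ(e^{−s}η) = exp(−3|ι|s − 2Σ_i log(1 + e^{−2s}|η_i|²))`, ★ `hasDerivAt_weightPath` (derivative `(Σ_i W(e^{−s}η_i) − 3|ι|)·weightPath`),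
  the domination `|weightPath η s| ≤ e^{3|ι|}·e^{4|ι|}·ρ(η)` on `|s| ≤ 1`, and ★★ `hasDerivAt_integral_weightPath` (dominated differentiation under `∫`);
* §4 ★★ `hasDerivAt_integral_dilate` — `d/ds|₀ ∫ g(e^s η)ρ = ∫ g·(ΣW − 3|ι|)·ρ` for every bounded measurable `g`; `hasDerivAt_flow`; ★★ `hasDerivAt_integral_dilate_flow`
  — `= ∫ (Xg)·ρ` when the flow derivative `Xg η = d/ds|₀ g(e^s η)` exists everywhere and is bounded measurable; ★★★ `integral_flowDeriv_mul_piWeight` — THE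
  DILATION IDENTITY `∫ (Xg)·ρ = ∫ g·(Σ_i W(η_i) − 3|ι|)·ρ` (uniqueness of the derivative).  With `g = e^{−bF̂}` (bounded by `1`, flow derivative `−b(XF̂)e^{−bF̂}`)
  this is the followers' virial identity `b·∫(XF̂)e^{−bF̂}ρ = ∫(3|ι| − ΣW)e^{−bF̂}ρ` of the memo (brick G3, to follow, after the product gnomonic chart G1).

HONEST LABEL: real-analysis plumbing for the window programme of a DRAFT line; no statement about the ring, ⟨24197⟩ (window-uniform) ∕ ⟨24194⟩ ∕ ⟨24497⟩ OPEN;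
own crux ⟨22884⟩ OPEN (blocked-on ⟨19935⟩); no crux, rung of record or summit is proved; the Yang–Mills mass gap is NOT proved; no summit is proved by a line.
Five `def`s (`normSq3`, `gnomonicWeight`, `gnomonicW`, `piWeight`, `weightPath`), theorems otherwise; 0 `sorry`; standard axioms.  Width seat ym-line-sfw-p2-w2 g57
(cell ym-idea-1, free hands), `--supports stmt-QuantumFields-24197`.  References: [cite: Chatterjee2026YMHiggs, Lemma 5.1 and Cor. 5.2 (Haar on SU(2) in coordinates)];
[folklore].
-/

set_option autoImplicit false

noncomputable section

open MeasureTheory Set Filter Topology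
open scoped BigOperators ENNReal

namespace Summit.QuantumFields.YangMills.Theorems.SwapVirialDeficit.Gnomonic

variable {ι : Type*} [Fintype ι]

/-! ## §1 The gnomonic weight, its dilations and its mass -/

/-- `|v|² = Σ_j v_j²` on `ℝ³ = Fin 3 → ℝ`. [folklore] -/
def normSq3 (v : Fin 3 → ℝ) : ℝ := ∑ j, v j ^ 2

/-- The GNOMONIC WEIGHT `w(v) = (1 + |v|²)⁻²` of Haar on `SU(2)` in the gnomonic chart (✓`lintegral_haarProbability_su2_gnomonic`). [folklore] -/
def gnomonicWeight (v : Fin 3 → ℝ) : ℝ := ((1 + normSq3 v)⁻¹) ^ 2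

/-- The DILATION DEFECT `W(v) = 4|v|²/(1 + |v|²)` of the gnomonic weight: `d/ds log w(e^{−s} v) = W(e^{−s} v)`. [folklore] -/
def gnomonicW (v : Fin 3 → ℝ) : ℝ := 4 * normSq3 v / (1 + normSq3 v)

/-- The product weight `ρ(η) = ∏_i w(η_i)` on `(ℝ³)^ι`. [folklore] -/
def piWeight (η : ι → Fin 3 → ℝ) : ℝ := ∏ i, gnomonicWeight (η i)

omit [Fintype ι] in
/-- `0 ≤ |v|²`. [folklore] -/
theorem normSq3_nonneg (v : Fin 3 → ℝ) : 0 ≤ normSq3 v := Finset.sum_nonneg fun j _ => sq_nonneg (v j)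

omit [Fintype ι] in
/-- `|c v|² = c²|v|²`. [folklore] -/
theorem normSq3_smul (c : ℝ) (v : Fin 3 → ℝ) : normSq3 (c • v) = c ^ 2 * normSq3 v := by
  unfold normSq3
  rw [Finset.mul_sum]
  exact Finset.sum_congr rfl fun j _ => by rw [Pi.smul_apply, smul_eq_mul]; ring

omit [Fintype ι] in
/-- `0 < w(v) ≤ 1`. [folklore] -/
theorem gnomonicWeight_pos (v : Fin 3 → ℝ) : 0 < gnomonicWeight v := by
  unfold gnomonicWeight; have := normSq3_nonneg v; positivity

omit [Fintype ι] in
/-- `w ≤ 1`. [folklore] -/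
theorem gnomonicWeight_le_one (v : Fin 3 → ℝ) : gnomonicWeight v ≤ 1 := by
  unfold gnomonicWeight
  have h := normSq3_nonneg v
  have h1 : (1 + normSq3 v)⁻¹ ≤ 1 := inv_le_one_of_one_le₀ (by linarith)
  have h0 : 0 ≤ (1 + normSq3 v)⁻¹ := by positivity
  nlinarith

omit [Fintype ι] in
/-- `0 ≤ W(v) ≤ 4`. [folklore] -/
theorem gnomonicW_nonneg_le (v : Fin 3 → ℝ) : 0 ≤ gnomonicW v ∧ gnomonicW v ≤ 4 := by
  unfold gnomonicW
  have h := normSq3_nonneg v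
  refine ⟨by positivity, ?_⟩
  rw [div_le_iff₀ (by linarith)]
  linarith

/-- `0 < ρ`. [folklore] -/
theorem piWeight_pos (η : ι → Fin 3 → ℝ) : 0 < piWeight η := Finset.prod_pos fun i _ => gnomonicWeight_pos (η i)

/-- `ρ ≤ 1`. [folklore] -/
theorem piWeight_le_one (η : ι → Fin 3 → ℝ) : piWeight η ≤ 1 :=
  Finset.prod_le_one (fun i _ => (gnomonicWeight_pos (η i)).le) fun i _ => gnomonicWeight_le_one (η i)

omit [Fintype ι] in
/-- `w` is continuous. [folklore] -/
theorem continuous_gnomonicWeight : Continuous gnomonicWeight := by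
  have h : Continuous normSq3 := by unfold normSq3; fun_prop
  have h1 : Continuous fun v : Fin 3 → ℝ => 1 + normSq3 v := continuous_const.add h
  unfold gnomonicWeight
  refine (h1.inv₀ fun v => ?_).pow 2
  have := normSq3_nonneg v
  exact ne_of_gt (by linarith)

/-- `ρ` is continuous. [folklore] -/
theorem continuous_piWeight : Continuous (piWeight (ι := ι)) := by
  unfold piWeight
  exact continuous_finsetProd _ fun i _ => continuous_gnomonicWeight.comp (continuous_apply i)

omit [Fintype ι] in
/-- ★ **The mass of the gnomonic weight is `π²`**: `∫ w = π²` (the chart formula ✓`lintegral_haarProbability_su2_gnomonic` with `F ≡ 1`). [folklore] -/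
theorem lintegral_gnomonicWeight : ∫⁻ v : Fin 3 → ℝ, ENNReal.ofReal (gnomonicWeight v) = ENNReal.ofReal (Real.pi ^ 2) := by
  have h := Literature.MathematicalPhysics.QuantumLattice.lintegral_haarProbability_su2_gnomonic (fun _ => 1) measurable_const
  simp only [lintegral_const, measure_univ, mul_one] at h
  have e : (fun v : Fin 3 → ℝ => ((1 : ℝ≥0∞) + 1) * ENNReal.ofReal (((1 + ∑ i, v i ^ 2)⁻¹) ^ 2)) =
      fun v => 2 * ENNReal.ofReal (gnomonicWeight v) := by
    funext v; rw [one_add_one_eq_two]; rfl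
  have hm : Measurable fun v : Fin 3 → ℝ => ENNReal.ofReal (gnomonicWeight v) := ENNReal.measurable_ofReal.comp continuous_gnomonicWeight.measurable
  rw [e, lintegral_const_mul _ hm] at h
  have hpi : 0 < Real.pi ^ 2 := by positivity
  have h2 : ENNReal.ofReal (1 / (2 * Real.pi ^ 2)) * 2 = (ENNReal.ofReal (Real.pi ^ 2))⁻¹ := by
    rw [show (2 : ℝ≥0∞) = ENNReal.ofReal 2 by simp, ← ENNReal.ofReal_mul (by positivity), ← ENNReal.ofReal_inv_of_pos hpi]
    congr 1; field_simp
  rw [← mul_assoc, h2] at h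
  have hne : ENNReal.ofReal (Real.pi ^ 2) ≠ 0 := by rw [ne_eq, ENNReal.ofReal_eq_zero, not_le]; exact hpi
  have htop : ENNReal.ofReal (Real.pi ^ 2) ≠ ∞ := ENNReal.ofReal_ne_top
  calc ∫⁻ v : Fin 3 → ℝ, ENNReal.ofReal (gnomonicWeight v)
      = ENNReal.ofReal (Real.pi ^ 2) * ((ENNReal.ofReal (Real.pi ^ 2))⁻¹ * ∫⁻ v : Fin 3 → ℝ, ENNReal.ofReal (gnomonicWeight v)) := by
        rw [← mul_assoc, ENNReal.mul_inv_cancel hne htop, one_mul]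
    _ = ENNReal.ofReal (Real.pi ^ 2) := by rw [← h, mul_one]

omit [Fintype ι] in
/-- `w` is integrable on `ℝ³`. [folklore] -/
theorem integrable_gnomonicWeight : Integrable gnomonicWeight (volume : Measure (Fin 3 → ℝ)) := by
  refine ⟨continuous_gnomonicWeight.aestronglyMeasurable, ?_⟩
  rw [hasFiniteIntegral_iff_ofReal (ae_of_all _ fun v => (gnomonicWeight_pos v).le), lintegral_gnomonicWeight]
  exact ENNReal.ofReal_lt_top

/-- ★ `ρ` is integrable on `(ℝ³)^ι` (product of integrable factors, `Integrable.fintype_prod`). [folklore] -/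
theorem integrable_piWeight : Integrable (piWeight (ι := ι)) (volume : Measure (ι → Fin 3 → ℝ)) := by
  have h := Integrable.fintype_prod (ι := ι) (f := fun _ : ι => gnomonicWeight) (μ := fun _ => (volume : Measure (Fin 3 → ℝ)))
    fun _ => integrable_gnomonicWeight
  exact h

/-! ## §2 Dilations: the linear change of variables -/

/-- The blow-up space `(ℝ³)^ι` has dimension `3|ι|`. [folklore] -/
theorem finrank_pi3 : Module.finrank ℝ (ι → Fin 3 → ℝ) = Fintype.card ι * 3 := by
  rw [Module.finrank_pi_fintype]
  simp only [Module.finrank_fin_fun, Finset.sum_const, Finset.card_univ, smul_eq_mul]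

omit [Fintype ι] in
/-- `w(e^{-s}·(e^{s}·v)) = w(v)`-type bookkeeping: `e^{-s} • e^{s} • η = η`. [folklore] -/
theorem exp_neg_smul_exp_smul (s : ℝ) (η : ι → Fin 3 → ℝ) : Real.exp (-s) • Real.exp s • η = η := by
  rw [smul_smul, ← Real.exp_add, neg_add_cancel, Real.exp_zero, one_smul]

/-- ★ **Linear change of variables under the dilation `η ↦ e^s η`**:
`∫ g(e^s η)·ρ(η) dη = e^{−3|ι|s} · ∫ g(η)·ρ(e^{−s} η) dη` (Lebesgue measure on `(ℝ³)^ι` scales by `e^{3|ι|s}`). [folklore] -/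
theorem integral_comp_dilate (g : (ι → Fin 3 → ℝ) → ℝ) (s : ℝ) :
    ∫ η : ι → Fin 3 → ℝ, g (Real.exp s • η) * piWeight η =
      Real.exp (-(3 * (Fintype.card ι : ℝ) * s)) * ∫ η : ι → Fin 3 → ℝ, g η * piWeight (Real.exp (-s) • η) := by
  have h := Measure.integral_comp_smul_of_nonneg (volume : Measure (ι → Fin 3 → ℝ))
    (fun η : ι → Fin 3 → ℝ => g η * piWeight (Real.exp (-s) • η)) (Real.exp s) (hR := (Real.exp_pos s).le)
  have e : (fun η : ι → Fin 3 → ℝ => (fun η' : ι → Fin 3 → ℝ => g η' * piWeight (Real.exp (-s) • η')) (Real.exp s • η)) =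
      fun η => g (Real.exp s • η) * piWeight η := by
    funext η; simp only [exp_neg_smul_exp_smul]
  rw [e] at h
  rw [h, smul_eq_mul, finrank_pi3, ← Real.exp_nat_mul, ← Real.exp_neg]
  congr 1
  congr 1
  push_cast
  ring

/-! ## §3 The dilated weight and its derivative in the dilation parameter -/

/-- The dilated weight `e^{−3|ι|s}·ρ(e^{−s}η)` (the density of the dilated gnomonic measure against Lebesgue). [folklore] -/
def weightPath (η : ι → Fin 3 → ℝ) (s : ℝ) : ℝ := Real.exp (-(3 * (Fintype.card ι : ℝ) * s)) * piWeight (Real.exp (-s) • η)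

/-- `weightPath η 0 = ρ(η)`. [folklore] -/
theorem weightPath_zero (η : ι → Fin 3 → ℝ) : weightPath η 0 = piWeight η := by
  unfold weightPath; rw [mul_zero, neg_zero, Real.exp_zero, one_mul, one_smul]

/-- `|e^{−s} v|² = e^{−2s}|v|²`. [folklore] -/
theorem normSq3_exp_neg_smul (s : ℝ) (v : Fin 3 → ℝ) : normSq3 (Real.exp (-s) • v) = Real.exp (-(2 * s)) * normSq3 v := by
  rw [normSq3_smul, ← Real.exp_nat_mul]; congr 1; push_cast; ring_nf

/-- The dilated weight as an exponential: `e^{−3|ι|s}·ρ(e^{−s}η) = exp(−3|ι|s − 2 Σ_i log(1 + e^{−2s}|η_i|²))`. [folklore] -/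
theorem weightPath_eq_exp (η : ι → Fin 3 → ℝ) (s : ℝ) :
    weightPath η s = Real.exp (-(3 * (Fintype.card ι : ℝ) * s) - 2 * ∑ i, Real.log (1 + Real.exp (-(2 * s)) * normSq3 (η i))) := by
  unfold weightPath piWeight
  rw [sub_eq_add_neg, Real.exp_add, Finset.mul_sum, ← Finset.sum_neg_distrib, Real.exp_sum]
  congr 1
  refine Finset.prod_congr rfl fun i _ => ?_
  have hq : 0 < 1 + Real.exp (-(2 * s)) * normSq3 (η i) := by have := normSq3_nonneg (η i); positivity
  unfold gnomonicWeight
  rw [show (Real.exp (-s) • η) i = Real.exp (-s) • η i from rfl, normSq3_exp_neg_smul,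
    show -(2 * Real.log (1 + Real.exp (-(2 * s)) * normSq3 (η i))) = ((2 : ℕ) : ℝ) * Real.log ((1 + Real.exp (-(2 * s)) * normSq3 (η i))⁻¹) by
      rw [Real.log_inv]; push_cast; ring,
    Real.exp_nat_mul, Real.exp_log (inv_pos.2 hq)]

/-- ★ **The derivative of the dilated weight**: `d/ds [e^{−3|ι|s}·ρ(e^{−s}η)] = (Σ_i W(e^{−s}η_i) − 3|ι|)·e^{−3|ι|s}·ρ(e^{−s}η)`. [folklore] -/
theorem hasDerivAt_weightPath (η : ι → Fin 3 → ℝ) (s : ℝ) :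
    HasDerivAt (weightPath η) (((∑ i, gnomonicW (Real.exp (-s) • η i)) - 3 * (Fintype.card ι : ℝ)) * weightPath η s) s := by
  have hq : ∀ i, 0 < 1 + Real.exp (-(2 * s)) * normSq3 (η i) := fun i => by have := normSq3_nonneg (η i); positivity
  -- derivative of the exponent
  have hE : HasDerivAt (fun s : ℝ => -(3 * (Fintype.card ι : ℝ) * s) - 2 * ∑ i, Real.log (1 + Real.exp (-(2 * s)) * normSq3 (η i)))
      (-(3 * (Fintype.card ι : ℝ)) - 2 * ∑ i, (Real.exp (-(2 * s)) * (-2) * normSq3 (η i)) / (1 + Real.exp (-(2 * s)) * normSq3 (η i))) s := by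
    refine HasDerivAt.sub ?_ (HasDerivAt.const_mul 2 (HasDerivAt.fun_sum fun i _ => ?_))
    · have h := (hasDerivAt_id s).const_mul (-(3 * (Fintype.card ι : ℝ)))
      simpa [neg_mul] using h
    · have h1 : HasDerivAt (fun s : ℝ => Real.exp (-(2 * s))) (Real.exp (-(2 * s)) * (-2)) s := by
        have h := ((hasDerivAt_id s).const_mul (2 : ℝ)).neg.exp
        simpa using h
      have h2 : HasDerivAt (fun s : ℝ => 1 + Real.exp (-(2 * s)) * normSq3 (η i)) (Real.exp (-(2 * s)) * (-2) * normSq3 (η i)) s := by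
        have h := (h1.mul_const (normSq3 (η i))).const_add 1
        simpa using h
      exact h2.log (hq i).ne'
  have hexp := hE.exp
  have efun : (fun s : ℝ => Real.exp (-(3 * (Fintype.card ι : ℝ) * s) - 2 * ∑ i, Real.log (1 + Real.exp (-(2 * s)) * normSq3 (η i)))) =
      weightPath η := funext fun s => (weightPath_eq_exp η s).symm
  rw [efun] at hexp
  convert hexp using 1
  rw [← weightPath_eq_exp, mul_comm]
  congr 1
  have eW : ∀ i, gnomonicW (Real.exp (-s) • η i) = 4 * (Real.exp (-(2 * s)) * normSq3 (η i)) / (1 + Real.exp (-(2 * s)) * normSq3 (η i)) := by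
    intro i; unfold gnomonicW; rw [normSq3_exp_neg_smul]
  simp only [eW]
  rw [Finset.mul_sum]
  have : ∀ i, 2 * (Real.exp (-(2 * s)) * -2 * normSq3 (η i) / (1 + Real.exp (-(2 * s)) * normSq3 (η i))) =
      -(4 * (Real.exp (-(2 * s)) * normSq3 (η i)) / (1 + Real.exp (-(2 * s)) * normSq3 (η i))) := fun i => by ring
  simp only [this, Finset.sum_neg_distrib]
  ring

/-- For `s ≤ 1`: `w(e^{−s}v) ≤ e⁴·w(v)`. [folklore] -/
theorem gnomonicWeight_dilate_le {s : ℝ} (hs : s ≤ 1) (v : Fin 3 → ℝ) : gnomonicWeight (Real.exp (-s) • v) ≤ Real.exp 4 * gnomonicWeight v := by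
  unfold gnomonicWeight
  rw [normSq3_exp_neg_smul]
  have ha := normSq3_nonneg v
  have h1 : (1 : ℝ) ≤ Real.exp 2 := Real.one_le_exp_iff.2 (by norm_num)
  have h2 : (1 : ℝ) ≤ Real.exp 2 * Real.exp (-(2 * s)) := by
    rw [← Real.exp_add]; exact Real.one_le_exp_iff.2 (by linarith)
  have hq : 0 < 1 + Real.exp (-(2 * s)) * normSq3 v := by positivity
  have key : (1 + Real.exp (-(2 * s)) * normSq3 v)⁻¹ ≤ Real.exp 2 * (1 + normSq3 v)⁻¹ := by
    rw [inv_le_comm₀ (inv_pos.2 hq |> fun h => by positivity) (by positivity)]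
    rw [mul_inv, inv_inv, ← div_eq_inv_mul, div_le_iff₀ (by positivity)]
    nlinarith
  have h0 : 0 ≤ (1 + Real.exp (-(2 * s)) * normSq3 v)⁻¹ := by positivity
  calc ((1 + Real.exp (-(2 * s)) * normSq3 v)⁻¹) ^ 2 ≤ (Real.exp 2 * (1 + normSq3 v)⁻¹) ^ 2 := pow_le_pow_left₀ h0 key 2
    _ = Real.exp 4 * ((1 + normSq3 v)⁻¹) ^ 2 := by rw [mul_pow, ← Real.exp_nat_mul]; norm_num

/-- For `s ≤ 1`: `ρ(e^{−s}η) ≤ e^{4|ι|}·ρ(η)`. [folklore] -/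
theorem piWeight_dilate_le {s : ℝ} (hs : s ≤ 1) (η : ι → Fin 3 → ℝ) :
    piWeight (Real.exp (-s) • η) ≤ Real.exp 4 ^ Fintype.card ι * piWeight η := by
  unfold piWeight
  rw [← Finset.card_univ, ← Finset.prod_const, ← Finset.prod_mul_distrib]
  exact Finset.prod_le_prod (fun i _ => (gnomonicWeight_pos _).le) fun i _ => gnomonicWeight_dilate_le hs (η i)

/-- For `|s| ≤ 1`: `|e^{−3|ι|s}·ρ(e^{−s}η)| ≤ e^{3|ι|}·e^{4|ι|}·ρ(η)`. [folklore] -/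
theorem weightPath_le {s : ℝ} (hs : |s| ≤ 1) (η : ι → Fin 3 → ℝ) :
    |weightPath η s| ≤ Real.exp (3 * (Fintype.card ι : ℝ)) * (Real.exp 4 ^ Fintype.card ι * piWeight η) := by
  have hs1 : s ≤ 1 := (le_abs_self s).trans hs
  have hs2 : -1 ≤ s := by have := neg_abs_le s; linarith
  unfold weightPath
  rw [abs_mul, abs_of_pos (Real.exp_pos _), abs_of_pos (piWeight_pos _)]
  refine mul_le_mul ?_ (piWeight_dilate_le hs1 η) (piWeight_pos _).le (Real.exp_pos _).le
  refine Real.exp_le_exp.2 ?_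
  have hn : (0 : ℝ) ≤ 3 * (Fintype.card ι : ℝ) := by positivity
  nlinarith

/-- ★★ **Differentiating the dilated weight under the integral**: for a bounded measurable `g`,
`d/ds|₀ ∫ g(η)·e^{−3|ι|s}·ρ(e^{−s}η) dη = ∫ g(η)·(Σ_i W(η_i) − 3|ι|)·ρ(η) dη` (dominated differentiation on `|s| < 1`). [folklore] -/
theorem hasDerivAt_integral_weightPath {g : (ι → Fin 3 → ℝ) → ℝ} (hg : Measurable g) {M : ℝ} (hbd : ∀ η, |g η| ≤ M) :
    HasDerivAt (fun s : ℝ => ∫ η : ι → Fin 3 → ℝ, g η * weightPath η s)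
      (∫ η : ι → Fin 3 → ℝ, g η * (((∑ i, gnomonicW (η i)) - 3 * (Fintype.card ι : ℝ)) * piWeight η)) 0 := by
  have hM : 0 ≤ M := (abs_nonneg _).trans (hbd 0)
  set n : ℝ := (Fintype.card ι : ℝ) with hn
  have hn0 : 0 ≤ n := by rw [hn]; positivity
  have hwm : ∀ s : ℝ, Measurable fun η : ι → Fin 3 → ℝ => weightPath η s := fun s => by
    unfold weightPath
    exact measurable_const.mul (continuous_piWeight.measurable.comp (measurable_const_smul _))
  have hWm : ∀ s : ℝ, Measurable fun η : ι → Fin 3 → ℝ => (∑ i, gnomonicW (Real.exp (-s) • η i)) - 3 * n := fun s => by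
    refine (Finset.measurable_sum _ fun i _ => ?_).sub measurable_const
    have hc : Continuous gnomonicW := by
      have h : Continuous normSq3 := by unfold normSq3; fun_prop
      unfold gnomonicW
      refine (continuous_const.mul h).div (continuous_const.add h) fun v => ?_
      have := normSq3_nonneg v; exact ne_of_gt (by linarith)
    exact hc.measurable.comp ((measurable_const_smul _).comp (measurable_pi_apply i))
  have key := hasDerivAt_integral_of_dominated_loc_of_deriv_le (μ := (volume : Measure (ι → Fin 3 → ℝ))) (x₀ := (0 : ℝ))
    (s := Metric.ball (0 : ℝ) 1) (F := fun s η => g η * weightPath η s)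
    (F' := fun s η => g η * ((((∑ i, gnomonicW (Real.exp (-s) • η i)) - 3 * n)) * weightPath η s))
    (bound := fun η => M * ((7 * n) * (Real.exp (3 * n) * (Real.exp 4 ^ Fintype.card ι * piWeight η))))
    (Metric.ball_mem_nhds 0 one_pos) ?_ ?_ ?_ ?_ ?_ ?_
  · have e : (fun η : ι → Fin 3 → ℝ => g η * (((∑ i, gnomonicW (Real.exp (-(0 : ℝ)) • η i)) - 3 * n) * weightPath η 0)) =
        fun η => g η * (((∑ i, gnomonicW (η i)) - 3 * n) * piWeight η) := by
      funext η; simp only [neg_zero, Real.exp_zero, one_smul, weightPath_zero]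
    rw [e] at key
    exact key.2
  · exact Eventually.of_forall fun s => (hg.mul (hwm s)).aestronglyMeasurable
  · -- integrability at `s = 0`
    refine Integrable.mono' (integrable_piWeight.const_mul M) (hg.mul (hwm 0)).aestronglyMeasurable (ae_of_all _ fun η => ?_)
    rw [weightPath_zero, Real.norm_eq_abs, abs_mul, abs_of_pos (piWeight_pos η)]
    exact mul_le_mul_of_nonneg_right (hbd η) (piWeight_pos η).le
  · exact (hg.mul ((hWm 0).mul (hwm 0))).aestronglyMeasurable
  · refine ae_of_all _ fun η s hs => ?_
    have hs' : |s| ≤ 1 := by rw [Metric.mem_ball, dist_zero_right, Real.norm_eq_abs] at hs; exact hs.le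
    rw [Real.norm_eq_abs, abs_mul, abs_mul]
    have hW : |(∑ i, gnomonicW (Real.exp (-s) • η i)) - 3 * n| ≤ 7 * n := by
      have h1 : 0 ≤ ∑ i, gnomonicW (Real.exp (-s) • η i) := Finset.sum_nonneg fun i _ => (gnomonicW_nonneg_le _).1
      have h2 : ∑ i, gnomonicW (Real.exp (-s) • η i) ≤ 4 * n := by
        have h := Finset.sum_le_sum fun i (_ : i ∈ Finset.univ) => (gnomonicW_nonneg_le (Real.exp (-s) • η i)).2
        rw [Finset.sum_const, Finset.card_univ, nsmul_eq_mul] at h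
        linarith
      rw [abs_le]; constructor <;> linarith
    have h7 : 0 ≤ 7 * n := by positivity
    exact mul_le_mul (hbd η) (mul_le_mul hW (weightPath_le hs' η) (abs_nonneg _) h7) (by positivity) hM
  · exact (((integrable_piWeight.const_mul (Real.exp 4 ^ Fintype.card ι)).const_mul (Real.exp (3 * n))).const_mul (7 * n)).const_mul M
  · exact ae_of_all _ fun η s _ => (hasDerivAt_weightPath η s).const_mul (g η)

/-! ## §4 The flow derivative and the dilation identity -/

/-- ★★ **The dilation integral is differentiable with derivative `∫ g·(ΣW − 3|ι|)·ρ`**: for bounded measurable `g`,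
`d/ds|₀ ∫ g(e^s η)·ρ(η) dη = ∫ g(η)·(Σ_i W(η_i) − 3|ι|)·ρ(η) dη` (change of variables `integral_comp_dilate`, then `hasDerivAt_integral_weightPath`). [folklore] -/
theorem hasDerivAt_integral_dilate {g : (ι → Fin 3 → ℝ) → ℝ} (hg : Measurable g) {M : ℝ} (hbd : ∀ η, |g η| ≤ M) :
    HasDerivAt (fun s : ℝ => ∫ η : ι → Fin 3 → ℝ, g (Real.exp s • η) * piWeight η)
      (∫ η : ι → Fin 3 → ℝ, g η * (((∑ i, gnomonicW (η i)) - 3 * (Fintype.card ι : ℝ)) * piWeight η)) 0 := by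
  have e : (fun s : ℝ => ∫ η : ι → Fin 3 → ℝ, g (Real.exp s • η) * piWeight η) = fun s => ∫ η : ι → Fin 3 → ℝ, g η * weightPath η s := by
    funext s
    rw [integral_comp_dilate, ← integral_const_mul]
    refine integral_congr_ae (ae_of_all _ fun η => ?_)
    unfold weightPath; ring
  rw [e]
  exact hasDerivAt_integral_weightPath hg hbd

omit [Fintype ι] in
/-- The flow property: a derivative at `s = 0` along `s ↦ g(e^s η)` for every `η` gives the derivative at every `s`. [folklore] -/
theorem hasDerivAt_flow {g : (ι → Fin 3 → ℝ) → ℝ} {Xg : (ι → Fin 3 → ℝ) → ℝ}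
    (hX : ∀ η, HasDerivAt (fun s : ℝ => g (Real.exp s • η)) (Xg η) 0) (η : ι → Fin 3 → ℝ) (s : ℝ) :
    HasDerivAt (fun s' : ℝ => g (Real.exp s' • η)) (Xg (Real.exp s • η)) s := by
  have h := hX (Real.exp s • η)
  have e : (fun s' : ℝ => g (Real.exp s' • η)) = (fun u : ℝ => g (Real.exp u • (Real.exp s • η))) ∘ fun s' => s' - s := by
    funext s'
    simp only [Function.comp_apply, smul_smul, ← Real.exp_add, sub_add_cancel]
  rw [e]
  have hsub : HasDerivAt (fun s' : ℝ => s' - s) 1 s := by simpa using (hasDerivAt_id s).sub_const s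
  have h0 : HasDerivAt (fun u : ℝ => g (Real.exp u • Real.exp s • η)) (Xg (Real.exp s • η)) ((fun s' : ℝ => s' - s) s) := by
    simp only [sub_self]; exact h
  have hc := HasDerivAt.scomp (h := fun s' : ℝ => s' - s) s h0 hsub
  simpa using hc

/-- ★★ **Differentiating along the flow under the integral**: if `g` is bounded measurable and `s ↦ g(e^s η)` has derivative `Xg η` at `0` for every `η`, with
`Xg` bounded measurable, then `d/ds|₀ ∫ g(e^s η)·ρ(η) dη = ∫ (Xg)·ρ`. [folklore] -/
theorem hasDerivAt_integral_dilate_flow {g Xg : (ι → Fin 3 → ℝ) → ℝ} (hg : Measurable g) {M : ℝ} (hbd : ∀ η, |g η| ≤ M)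
    (hX : ∀ η, HasDerivAt (fun s : ℝ => g (Real.exp s • η)) (Xg η) 0) (hXm : Measurable Xg) {M' : ℝ} (hXbd : ∀ η, |Xg η| ≤ M') :
    HasDerivAt (fun s : ℝ => ∫ η : ι → Fin 3 → ℝ, g (Real.exp s • η) * piWeight η) (∫ η : ι → Fin 3 → ℝ, Xg η * piWeight η) 0 := by
  have hM' : 0 ≤ M' := (abs_nonneg _).trans (hXbd 0)
  have key := hasDerivAt_integral_of_dominated_loc_of_deriv_le (μ := (volume : Measure (ι → Fin 3 → ℝ))) (x₀ := (0 : ℝ))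
    (s := Metric.ball (0 : ℝ) 1) (F := fun s η => g (Real.exp s • η) * piWeight η) (F' := fun s η => Xg (Real.exp s • η) * piWeight η)
    (bound := fun η => M' * piWeight η) (Metric.ball_mem_nhds 0 one_pos) ?_ ?_ ?_ ?_ ?_ ?_
  · simpa only [Real.exp_zero, one_smul] using key.2
  · exact Eventually.of_forall fun s => ((hg.comp (measurable_const_smul _)).mul continuous_piWeight.measurable).aestronglyMeasurable
  · refine Integrable.mono' (integrable_piWeight.const_mul M) ((hg.comp (measurable_const_smul _)).mul continuous_piWeight.measurable).aestronglyMeasurable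
      (ae_of_all _ fun η => ?_)
    rw [Real.norm_eq_abs, abs_mul, abs_of_pos (piWeight_pos η)]
    exact mul_le_mul_of_nonneg_right (hbd _) (piWeight_pos η).le
  · exact ((hXm.comp (measurable_const_smul _)).mul continuous_piWeight.measurable).aestronglyMeasurable
  · refine ae_of_all _ fun η s _ => ?_
    rw [Real.norm_eq_abs, abs_mul, abs_of_pos (piWeight_pos η)]
    exact mul_le_mul_of_nonneg_right (hXbd _) (piWeight_pos η).le
  · exact integrable_piWeight.const_mul _
  · exact ae_of_all _ fun η s _ => (hasDerivAt_flow hX η s).mul_const _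

/-- ★★★ **THE DILATION IDENTITY IN THE PRODUCT GNOMONIC CHART** (integration by parts for the Euler field, with NO boundary term): for a bounded
measurable `g` whose flow derivative `Xg η = d/ds|₀ g(e^s η)` exists everywhere and is bounded measurable,
`∫ (Xg)·ρ = ∫ g·(Σ_i W(η_i) − 3|ι|)·ρ`, `W(v) = 4|v|²/(1+|v|²)`.  With `g = e^{−bF̂}` this reads `b·∫(X F̂)e^{−bF̂}ρ = ∫(3|ι| − ΣW)e^{−bF̂}ρ`. [folklore] -/
theorem integral_flowDeriv_mul_piWeight {g Xg : (ι → Fin 3 → ℝ) → ℝ} (hg : Measurable g) {M : ℝ} (hbd : ∀ η, |g η| ≤ M)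
    (hX : ∀ η, HasDerivAt (fun s : ℝ => g (Real.exp s • η)) (Xg η) 0) (hXm : Measurable Xg) {M' : ℝ} (hXbd : ∀ η, |Xg η| ≤ M') :
    ∫ η : ι → Fin 3 → ℝ, Xg η * piWeight η =
      ∫ η : ι → Fin 3 → ℝ, g η * (((∑ i, gnomonicW (η i)) - 3 * (Fintype.card ι : ℝ)) * piWeight η) :=
  (hasDerivAt_integral_dilate_flow hg hbd hX hXm hXbd).unique (hasDerivAt_integral_dilate hg hbd)

end Summit.QuantumFields.YangMills.Theorems.SwapVirialDeficit.Gnomonic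

end
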